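import Mathlib
import HarnessLib
import Summits.HubbardSuperconductivity.HubbardSuperconductivity.Theorems.KLProgrammeKLRegimeTwoVolumeSrcUVLevelOneA
import Summits.HubbardSuperconductivity.HubbardSuperconductivity.Theorems.KLProgrammeKLRegimeEngineScaleOnePartitionFn
import Summits.HubbardSuperconductivity.HubbardSuperconductivity.Theorems.KLProgrammeKLRegimeTwoVolumeSrcTowerInduction
import Summits.HubbardSuperconductivity.HubbardSuperconductivity.Theorems.KLProgrammeKLRegimeVolumeLimitV11TowerDataOfSuppliers

/-!
# Route `KLProgramme` — K3 VL child (stmt-HubbardSuperconductivity-23356), HUV-W LEVELS 0 AND 1 TOGETHER, PRIMED (E1's degree-2 law at `ε_{n_β+1}`,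
# cure (c1) of «(VL)-HE1-LEVEL0-DEG2», pen (R313)) — ONE package `Q₀`, ONE amplitude `A₀`, every admissible frame (cell gate-hubbard-kl, seat p3 g21)

Twin of `…TwoVolumeSrcUVLevels` on `exists_sourceProfilesAtLevF_srcWindow_one'` (`…SrcUVLevelOneA`): the alive level-`0` read-out's law is asked only in the
degrees `2d ≥ 4`, its degree-`2` value obeys `S₀ 2 ≤ C₀·Q₁.CE·ε_{n_β+1}·4⁻¹` (`stub_vl_HE1free′`'s clause at `j = 0`).  Otherwise verbatim.

`stub_vl_srcUVW` (VL lead k3c4-p1 g20, image v12W-7): `∀ P R, WF → ∃ Q₀ … ∃ c₀ … ∃ U₀ … ∀ μ U β … ∃ A₀ … ∃ L₁ M₁, ∀ L M ≥ …, ∀ j ≤ 1, j + 1 ≤ n_β + 1 →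
SourceProfilesAtLevF L M (klSrcBudget P Q₀ U (fun _ _ => A₀) (j + 1)) β U μ (klFlowFrameU L M β U μ (n_β + 1)) (srcWindowFamily L M) j j (j + 1)`.
The unprimed file glues the two levels proved by this seat — level `0` (`exists_sourceProfilesAtLevF_srcWindow_zero`, unconditional given `FrameOK`) and level `1`
(`exists_sourceProfilesAtLevF_srcWindow_one`, given `FrameOK`, `Z^K_{Λ₁} ≠ 0`, the alive level-`0` read-out of `stub_vl_HE1free` and E1's overlap rows at
`k = 0`) — into that shape with ONE `Q₀` (CE := the max of the two thresholds, `klSrcBudget_mono_CE`) and ONE `A₀` (the max, `klSrcBudget_mono_A`), and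
DISCHARGES `Z^K_{Λ₁} ≠ 0` for every admissible frame (`exists_partitionFn_scaleOne_ne_zero`, p3 g21):

* **`exists_sourceProfilesAtLevF_srcWindow_levels'`** — `∀ P R, WF → ∀ Q₁ (0 ≤ CE) C₀ ≥ 0, CJ CJ′ → ∃ Q₀ (0 ≤ CE), ∃ c₀ > 0, ∀ c ≤ c₀, ∃ U₀ > 0, ∀ μ U β (regime),
  ∃ A₀ ≥ 0, ∀ L M ≥ (klEngL₃ β U, klEngM₃ β U L), ∀ K, FrameOK R U (nScales β) μ K → (S₀ clauses) → (rows, cols of E(F_1)S(F̃_0)) →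
  ∀ j ≤ 1, SourceProfilesAtLevF L M (klSrcBudget P Q₀ U (fun _ _ => A₀) (j + 1)) β U μ K (srcWindowFamily L M) j j (j + 1)`.

What separates this from the stub AS TYPED: the frame is GENERIC here (`FrameOK R U (nScales β) μ K`; the stub fixes `K = K_top = klFlowFrameU … (n_β+1)`, whose
`FrameOK` the tree derives only from the flow history, `frameOK_klFlowFrameU_of_histP_le`), and the two engine-lineage inputs at level `1` are hypotheses
(both in scope in the producer `srcProfilesHF_of_atomsT'`: `stub_vl_HE1free`'s level-`0` read-out, E1's `k = 0` overlap rows).  Everything is proved; no definitions, no sorry.  Nothing asserts HUV, HE1free, any stub, VL, K3 or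
superconductivity.  [cite: BenfattoGiulianiMastropietro2006, §2.7 (2.70)–(2.71a), §2.9 (4.3)–(4.8), §3 (3.2)–(3.8)]
-/

noncomputable section

namespace Summit.HubbardSuperconductivity.HubbardSuperconductivity.Theorems.TwoVolumeDefect

set_option linter.dupNamespace false -- summit = problem name (single-conjunct summit), D-0017

open Real Finset Literature.MathematicalPhysics.QuantumLattice GrassmannAlgebra Literature.Probability.LatticeModels
open Summit.HubbardSuperconductivity.HubbardSuperconductivity.Theorems.KLProgrammeLegKernels
open Summit.HubbardSuperconductivity.HubbardSuperconductivity.Theorems.KLRegimeSplit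
open Summit.HubbardSuperconductivity.HubbardSuperconductivity.Theorems.EngineV8
open Summit.HubbardSuperconductivity.HubbardSuperconductivity.Theorems.TwoVolumeSource

/-- **HUV-W, LEVELS 0 AND 1, ONE PACKAGE AND ONE AMPLITUDE, EVERY ADMISSIBLE FRAME** (see the module docstring).
[cite: BenfattoGiulianiMastropietro2006, §2.7 (2.70)-(2.71a), §2.9 (4.3)-(4.8), §3 (3.2)-(3.8)] -/
theorem exists_sourceProfilesAtLevF_srcWindow_levels' (P : SplitConsts) (R : RenConsts) (hP : P.WF) (hR : R.WF2)
    (Q₁ : EngConsts) (hQ₁ : 0 ≤ Q₁.CE) (C₀ : ℝ) (hC₀ : 0 ≤ C₀) (CJ CJ' : ℝ) :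
    ∃ Q₀ : EngConsts, 0 ≤ Q₀.CE ∧ ∃ c₀ : ℝ, 0 < c₀ ∧ ∀ c : ℝ, 0 < c → c ≤ c₀ → ∃ U₀ : ℝ, 0 < U₀ ∧
      ∀ μ ∈ klWindowC, ∀ U : ℝ, 0 < U → U ≤ U₀ → ∀ β : ℝ, klBetaMin ≤ β → β ≤ Real.exp (c / U ^ 2) →
        ∃ A₀ : ℝ, 0 ≤ A₀ ∧ ∀ (L M : ℕ) [NeZero L] [NeZero M], klEngL₃ β U ≤ L → klEngM₃ β U L ≤ M →
          ∀ K : TrigPolyC4v, FrameOK R U (nScales β) μ K →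
          ∀ S₀ : ℕ → ℝ, (∀ m, 0 ≤ S₀ m) → (∀ d, 2 ≤ d → S₀ (2 * d) ≤ C₀ * klWtBudget P Q₁ U 1 (2 * d)) →
            S₀ 2 ≤ C₀ * Q₁.CE * epsCoupling P U (nScales β + 1) * ((4 : ℝ) ^ (0 + 1))⁻¹ →
            (∀ (m : ℕ) (q : Fin m) (w : SpaceTimeIdx L M × SectorLeg (sectorCount 0)),
              klWtPinnedSumAt L M β μ K 0 0 m (klEffectiveAction L M β U μ K klE0 1) q w ≤ S₀ m) →
          (∀ X'', ∑ X', ‖(sectorAnalysisMatrix L M β (klAnisoFamily L M β μ K klE0 1) *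
              sectorSubMatrix L M β (bgmFatMultiplier L M klE0 β (nambuXiCT L μ K) 0)) X'' X'‖ *
              klScaleWt L M β 1 {latticeLegPos (2 * (2 * M)) X'', latticeLegPos (2 * (2 * M)) X'} ≤ 81 * CJ * M / β) →
          (∀ X', ∑ X'', ‖(sectorAnalysisMatrix L M β (klAnisoFamily L M β μ K klE0 1) *
              sectorSubMatrix L M β (bgmFatMultiplier L M klE0 β (nambuXiCT L μ K) 0)) X'' X'‖ *
              klScaleWt L M β 1 {latticeLegPos (2 * (2 * M)) X'', latticeLegPos (2 * (2 * M)) X'} ≤ 81 * (2 : ℝ) ^ 1 * CJ' * M / β) →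
          ∀ j : ℕ, j ≤ 1 →
            SourceProfilesAtLevF L M (klSrcBudget P Q₀ U (fun _ _ => A₀) (j + 1)) β U μ K (srcWindowFamily L M) j j (j + 1) := by
  have hKl0 : 0 ≤ P.Klam := le_trans zero_le_one hP.1
  obtain ⟨CE₀, hCE₀, c₀, hc₀, h0⟩ := exists_sourceProfilesAtLevF_srcWindow_zero P R hP hR
  obtain ⟨Qo, hQo, c₁, hc₁, h1⟩ := exists_sourceProfilesAtLevF_srcWindow_one' P R hP hR Q₁ hQ₁ C₀ hC₀ CJ CJ'
  obtain ⟨c₂, hc₂, hZ⟩ := exists_partitionFn_scaleOne_ne_zero P R hR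
  -- one package: CE := max CE₀ Qo.CE
  refine ⟨{ Qo with CE := max CE₀ Qo.CE }, hCE₀.trans (le_max_left _ _), min (min c₀ c₁) c₂, lt_min (lt_min hc₀ hc₁) hc₂, fun c hc hcc => ?_⟩
  obtain ⟨U₀, hU₀, h0'⟩ := h0 c hc (hcc.trans ((min_le_left _ _).trans (min_le_left _ _)))
  obtain ⟨U₁, hU₁, h1'⟩ := h1 c hc (hcc.trans ((min_le_left _ _).trans (min_le_right _ _)))
  obtain ⟨U₂, hU₂, hZ'⟩ := hZ c hc (hcc.trans (min_le_right _ _))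
  refine ⟨min (min U₀ U₁) U₂, lt_min (lt_min hU₀ hU₁) hU₂, fun μ hμ U hU hUU β hβ hβc => ?_⟩
  obtain ⟨A₀, hA₀, h0''⟩ := h0' μ hμ U hU (hUU.trans ((min_le_left _ _).trans (min_le_left _ _))) β hβ hβc
  obtain ⟨A₁, hA₁, h1''⟩ := h1' μ hμ U hU (hUU.trans ((min_le_left _ _).trans (min_le_right _ _))) β hβ hβc
  have hZ'' := hZ' μ hμ U hU (hUU.trans (min_le_right _ _)) β hβ hβc
  have hA₀0 : 0 ≤ A₀ := zero_le_one.trans hA₀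
  -- one amplitude: max A₀ A₁
  refine ⟨max A₀ A₁, hA₀0.trans (le_max_left _ _), fun L M _ _ hL hM K hK S₀ hS₀0 hS₀law hS₀two hS₀read hrow' hcol' j hj => ?_⟩
  have hZ := hZ'' L M hL hM K hK
  rcases Nat.le_one_iff_eq_zero_or_eq_one.1 hj with rfl | rfl
  · -- level 0: at the package `{Qo with CE := max …}` (CE ≥ CE₀), amplitude raised
    have h := h0'' L M hL hM K hK { Qo with CE := max CE₀ Qo.CE } (le_max_left _ _)
    exact h.mono fun s m => klSrcBudget_mono_A P _ U (hCE₀.trans (le_max_left _ _)) hKl0 (A := fun _ _ => A₀) (A' := fun _ _ => max A₀ A₁)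
      (fun _ _ => le_max_left _ _) _ s m
  · -- level 1: at `Qo`, package and amplitude raised
    have h := h1'' L M hL hM K hK hZ S₀ hS₀0 hS₀law hS₀two hS₀read hrow' hcol'
    refine h.mono fun s m => ?_
    exact (klSrcBudget_mono_CE P U (Q := Qo) (Q' := { Qo with CE := max CE₀ Qo.CE }) (A := fun _ _ => A₁) (fun _ _ => hA₁) hQo
      (le_max_right _ _) hKl0 _ s m).trans
      (klSrcBudget_mono_A P _ U (hCE₀.trans (le_max_left _ _)) hKl0 (A := fun _ _ => A₁) (A' := fun _ _ => max A₀ A₁)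
        (fun _ _ => le_max_right _ _) _ s m)

end Summit.HubbardSuperconductivity.HubbardSuperconductivity.Theorems.TwoVolumeDefect

end
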